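import Literature.Computability.QuantumComplexity.SignGatePrimitives
import HarnessLib

/-!
# Expanding `{H, Z, CZ, CCZ}` circuits into adjacent-qubit primitives

Topic `Literature/Computability/QuantumComplexity`; sequel of `SignGatePrimitives.lean`
(Aharonov–Arad 2011 §3.2: the gates of the simulated circuit are brought onto adjacent qubits by
swaps). We define the PRIMITIVE OPERATIONS the braid toolbox realises — `PrimOp n`: a Hadamard
or `Z` on a wire, a controlled phase `CP_{a,a+1}(u)`, `u ∈ {-1, i, -i}`, on adjacent wires — and an
explicit, list-valued (hence directly programmable) EXPANSION of every placed gate of the sign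
basis into primitives, with the exact matrix identities:

* `adjSwapOps b` (nine primitives) multiplies to the transposition `P_{(b, b+1)}`
  (`opsMat_adjSwapOps`); `chainPerm lo d`, the product of adjacent transpositions bringing wire
  `lo + 1 + d` down to `lo + 1` while fixing `lo`, and its primitive list `chainOps` /
  its reverse (`opsMat_chainOps`, `opsMat_chainOps_reverse`);
* `cpOps i j u` — a controlled phase on arbitrary wires `i ≠ j` (`opsMat_cpOps`);
* `expandGate`, `expandGates` — the expansion of a gate / a circuit (oracle gates, absent from
  QSIM instances proper, expand to nothing), and **`opsMat_expandGates`**: for an oracle-free gate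
  list `gs`, `QCircuit.toMatrix` of `gs` is the product of the primitive matrices of
  `expandGates gs`.

## References

* D. Aharonov, I. Arad, New J. Phys. 13 (2011) 035019, §3.2 [AharonovArad2011].
* A. Barenco et al., Phys. Rev. A 52 (1995) 3457, Lemma 6.1 [BarencoEtAl1995].
-/

noncomputable section

namespace Literature.Computability.QuantumComplexity

open Matrix Cryptography Complex

variable {n : ℕ}

/-! ### Primitive operations -/

/-- The three controlled phases the gadgets implement: `-1` (`CZ`), `i` (`CS`), `-i` (`CS†`). [cite: AharonovArad2011, §3.2] -/
inductive PhaseK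
  | neg | posI | negI
  deriving DecidableEq, Repr

/-- The phase as a complex number. [folklore] -/
def PhaseK.val : PhaseK → ℂ
  | neg => -1
  | posI => I
  | negI => -I

/-- **Primitive operations** on `n` wires. [cite: AharonovArad2011, §3.2] -/
inductive PrimOp (n : ℕ)
  | had (a : Fin n)
  | zed (a : Fin n)
  | cp (a : ℕ) (ha : a + 2 ≤ n) (u : PhaseK)

/-- The matrix of a primitive. [cite: AharonovArad2011, §3.2] -/
def PrimOp.mat : PrimOp n → Matrix (QReg n) (QReg n) ℂ
  | PrimOp.had a => placeGate (wireEmb a) hGate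
  | PrimOp.zed a => placeGate (wireEmb a) pauliZ
  | PrimOp.cp a ha u => Gadget.ctrlPhase a ha u.val

/-- The matrix of a list of primitives, in OPERATOR order (the head is the leftmost factor, i.e.
acts last). [folklore] -/
def opsMat (l : List (PrimOp n)) : Matrix (QReg n) (QReg n) ℂ := (l.map PrimOp.mat).prod

/-- `opsMat [] = 1`. [folklore] -/
@[simp] theorem opsMat_nil : opsMat ([] : List (PrimOp n)) = 1 := by simp [opsMat]

/-- `opsMat (p :: l) = p.mat * opsMat l`. [folklore] -/
@[simp] theorem opsMat_cons (p : PrimOp n) (l : List (PrimOp n)) : opsMat (p :: l) = p.mat * opsMat l := by simp [opsMat]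

/-- `opsMat (l ++ l') = opsMat l * opsMat l'`. [folklore] -/
theorem opsMat_append (l l' : List (PrimOp n)) : opsMat (l ++ l') = opsMat l * opsMat l' := by
  simp [opsMat, List.prod_append]

/-! ### The adjacent transposition -/

/-- **The nine primitives of an adjacent swap** `(b, b+1)`: three CNOTs, each `H · CZ · H`.
[cite: AharonovArad2011, §3.2] -/
def adjSwapOps (b : ℕ) (hb : b + 2 ≤ n) : List (PrimOp n) :=
  [PrimOp.had ⟨b + 1, by omega⟩, PrimOp.cp b hb PhaseK.neg, PrimOp.had ⟨b + 1, by omega⟩,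
    PrimOp.had ⟨b, by omega⟩, PrimOp.cp b hb PhaseK.neg, PrimOp.had ⟨b, by omega⟩,
    PrimOp.had ⟨b + 1, by omega⟩, PrimOp.cp b hb PhaseK.neg, PrimOp.had ⟨b + 1, by omega⟩]

/-- The adjacent transposition `(b, b+1)`. [folklore] -/
def adjSwap (b : ℕ) (hb : b + 2 ≤ n) : Equiv.Perm (Fin n) := Equiv.swap ⟨b, by omega⟩ ⟨b + 1, by omega⟩

/-- **The nine primitives multiply to `P_{(b, b+1)}`.** [cite: AharonovArad2011, §3.2] -/
theorem opsMat_adjSwapOps (b : ℕ) (hb : b + 2 ≤ n) : opsMat (adjSwapOps b hb) = permGate (adjSwap b hb) := by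
  have hij : (⟨b, by omega⟩ : Fin n) ≠ ⟨b + 1, by omega⟩ := by simp
  have hcz1 : placeGate (pairEmb (⟨b, by omega⟩ : Fin n) ⟨b + 1, by omega⟩ hij) cz = Gadget.ctrlPhase b hb (-1) := by
    rw [cz_eq_cphase, placeGate_pairEmb_cphase_adj b hb]
  have hcz2 : placeGate (pairEmb (⟨b + 1, by omega⟩ : Fin n) ⟨b, by omega⟩ hij.symm) cz = Gadget.ctrlPhase b hb (-1) := by
    rw [cz_eq_cphase, ← placeGate_pairEmb_cphase_comm hij, placeGate_pairEmb_cphase_adj b hb]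
  rw [adjSwap, permGate_swap_eq_prod hij, hcz1, hcz2]
  simp only [adjSwapOps, opsMat_cons, opsMat_nil, Matrix.mul_one, PrimOp.mat, PhaseK.val, Matrix.mul_assoc]

/-- The adjacent swap block is a palindrome. [folklore] -/
theorem reverse_adjSwapOps (b : ℕ) (hb : b + 2 ≤ n) : (adjSwapOps b hb).reverse = adjSwapOps b hb := by
  simp [adjSwapOps]

/-- `P_{(b,b+1)}` is an involution. [folklore] -/
theorem adjSwap_symm (b : ℕ) (hb : b + 2 ≤ n) : (adjSwap b hb).symm = adjSwap (n := n) b hb := Equiv.symm_swap _ _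

/-- Inverse of a product of permutations. [folklore] -/
theorem Perm.symm_mul (σ τ : Equiv.Perm (Fin n)) : (σ * τ).symm = τ.symm * σ.symm := rfl

/-! ### Chains of adjacent transpositions -/

/-- **The chain** `swap(lo+1,lo+2) · swap(lo+2,lo+3) ⋯ swap(lo+d,lo+1+d)` (rightmost first): it
brings wire `lo + 1 + d` down to `lo + 1` and fixes `lo`. [cite: AharonovArad2011, §3.2] -/
def chainPerm (lo : ℕ) : ∀ d : ℕ, lo + 2 + d ≤ n → Equiv.Perm (Fin n)
  | 0, _ => 1
  | d + 1, h => chainPerm lo d (by omega) * adjSwap (lo + 1 + d) (by omega)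

/-- The primitives of the chain, in operator order. [cite: AharonovArad2011, §3.2] -/
def chainOps (lo : ℕ) : ∀ d : ℕ, lo + 2 + d ≤ n → List (PrimOp n)
  | 0, _ => []
  | d + 1, h => chainOps lo d (by omega) ++ adjSwapOps (lo + 1 + d) (by omega)

/-- `permGate` is a homomorphism (product form). [folklore] -/
theorem permGate_mul' (π ρ : Equiv.Perm (Fin n)) : permGate (π * ρ) = permGate π * permGate ρ := by
  rw [permGate_mul_permGate]; rfl

/-- **The chain's primitives multiply to its permutation matrix.** [cite: AharonovArad2011, §3.2] -/
theorem opsMat_chainOps (lo : ℕ) : ∀ (d : ℕ) (h : lo + 2 + d ≤ n), opsMat (chainOps lo d h) = permGate (chainPerm lo d h)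
  | 0, _ => by simp [chainOps, chainPerm, ← permGate_refl]; rfl
  | d + 1, h => by
    rw [chainOps, chainPerm, opsMat_append, opsMat_chainOps lo d (by omega), opsMat_adjSwapOps, permGate_mul']

/-- **The reversed primitives multiply to the inverse permutation matrix.** [cite: AharonovArad2011, §3.2] -/
theorem opsMat_chainOps_reverse (lo : ℕ) : ∀ (d : ℕ) (h : lo + 2 + d ≤ n),
    opsMat (chainOps lo d h).reverse = permGate (chainPerm lo d h).symm
  | 0, _ => by simp [chainOps, chainPerm, ← permGate_refl]; rfl
  | d + 1, h => by
    rw [chainOps, chainPerm, List.reverse_append, opsMat_append, reverse_adjSwapOps, opsMat_chainOps_reverse lo d (by omega),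
      opsMat_adjSwapOps, Perm.symm_mul, permGate_mul', adjSwap_symm]

/-- **The chain fixes `lo`.** [folklore] -/
theorem chainPerm_apply_lo (lo : ℕ) : ∀ (d : ℕ) (h : lo + 2 + d ≤ n),
    chainPerm lo d h ⟨lo, by omega⟩ = ⟨lo, by omega⟩
  | 0, _ => rfl
  | d + 1, h => by
    rw [chainPerm, Equiv.Perm.mul_apply, adjSwap,
      Equiv.swap_apply_of_ne_of_ne (by simp [Fin.ext_iff]; omega) (by simp [Fin.ext_iff]; omega),
      chainPerm_apply_lo lo d (by omega)]

/-- **The chain brings `lo + 1 + d` down to `lo + 1`.** [folklore] -/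
theorem chainPerm_apply_hi (lo : ℕ) : ∀ (d : ℕ) (h : lo + 2 + d ≤ n),
    chainPerm lo d h ⟨lo + 1 + d, by omega⟩ = ⟨lo + 1, by omega⟩
  | 0, _ => rfl
  | d + 1, h => by
    rw [chainPerm, Equiv.Perm.mul_apply, adjSwap,
      show (⟨lo + 1 + (d + 1), by omega⟩ : Fin n) = ⟨lo + 1 + d + 1, by omega⟩ from Fin.ext (by simp; omega),
      Equiv.swap_apply_right, chainPerm_apply_hi lo d (by omega)]

/-! ### A controlled phase on arbitrary wires -/

/-- **The primitives of `CP_{ij}(u)`** for `i < j`: bring `j` down next to `i`, apply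
`CP_{i,i+1}(u)`, undo. [cite: AharonovArad2011, §3.2] -/
def cpOpsLt (i j : ℕ) (hij : i < j) (hj : j < n) (u : PhaseK) : List (PrimOp n) :=
  (chainOps i (j - i - 1) (by omega)).reverse ++ [PrimOp.cp i (by omega) u] ++ chainOps i (j - i - 1) (by omega)

/-- **`CP_{ij}(u)` on wires `i < j` as primitives.** [cite: AharonovArad2011, §3.2] -/
theorem opsMat_cpOpsLt (i j : ℕ) (hij : i < j) (hj : j < n) (u : PhaseK) :
    opsMat (cpOpsLt (n := n) i j hij hj u) = placeGate (pairEmb (⟨i, by omega⟩ : Fin n) ⟨j, hj⟩ (by simp; omega)) (cphase u.val) := by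
  rw [cpOpsLt, opsMat_append, opsMat_append, opsMat_chainOps_reverse, opsMat_chainOps, opsMat_cons, opsMat_nil, Matrix.mul_one,
    PrimOp.mat]
  rw [placeGate_cphase_eq_conj (π := chainPerm i (j - i - 1) (by omega)) (a := i) (ha := by omega)]
  · exact chainPerm_apply_lo i (j - i - 1) (by omega)
  · have e : (⟨j, hj⟩ : Fin n) = ⟨i + 1 + (j - i - 1), by omega⟩ := Fin.ext (by simp; omega)
    rw [e, chainPerm_apply_hi]

/-- **The primitives of `CP_{ij}(u)`** for any `i ≠ j` (symmetric in the wires). [cite: AharonovArad2011, §3.2] -/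
def cpOps (i j : Fin n) (h : i ≠ j) (u : PhaseK) : List (PrimOp n) :=
  if hlt : (i : ℕ) < j then cpOpsLt i j hlt j.isLt u else cpOpsLt j i (by omega) i.isLt u

/-- **`CP_{ij}(u)` as primitives.** [cite: AharonovArad2011, §3.2] -/
theorem opsMat_cpOps (i j : Fin n) (h : i ≠ j) (u : PhaseK) : opsMat (cpOps i j h u) = placeGate (pairEmb i j h) (cphase u.val) := by
  unfold cpOps
  split_ifs with hlt
  · rw [opsMat_cpOpsLt]
  · rw [opsMat_cpOpsLt, placeGate_pairEmb_cphase_comm h]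

/-! ### Expanding the gates of the sign basis -/

/-- **The expansion of a placed gate** (oracle gates expand to nothing). [cite: AharonovArad2011, §3.2] -/
def expandGate : QGate hSign n → List (PrimOp n)
  | QGate.gate HSignOp.H (e : Fin 1 ↪ Fin n) => [PrimOp.had (e 0)]
  | QGate.gate HSignOp.Z (e : Fin 1 ↪ Fin n) => [PrimOp.zed (e 0)]
  | QGate.gate HSignOp.CZ (e : Fin 2 ↪ Fin n) =>
      cpOps (e 0) (e 1) (fun h => by have := e.injective h; simp at this) PhaseK.neg
  | QGate.gate HSignOp.CCZ (e : Fin 3 ↪ Fin n) =>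
      cpOps (e 1) (e 2) (fun h => by have := e.injective h; simp at this) PhaseK.posI ++
        ([PrimOp.had (e 1)] ++ cpOps (e 0) (e 1) (fun h => by have := e.injective h; simp at this) PhaseK.neg ++ [PrimOp.had (e 1)]) ++
        cpOps (e 1) (e 2) (fun h => by have := e.injective h; simp at this) PhaseK.negI ++
        ([PrimOp.had (e 1)] ++ cpOps (e 0) (e 1) (fun h => by have := e.injective h; simp at this) PhaseK.neg ++ [PrimOp.had (e 1)]) ++
        cpOps (e 0) (e 2) (fun h => by have := e.injective h; simp at this) PhaseK.posI
  | QGate.oracle _ _ => []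

/-- **The expansion is exact** on gates of the basis. [cite: AharonovArad2011, §3.2] [cite: BarencoEtAl1995, Lemma 6.1] -/
theorem opsMat_expandGate_H (e : Fin 1 ↪ Fin n) :
    opsMat (expandGate (QGate.gate HSignOp.H e)) = (QGate.gate HSignOp.H e : QGate hSign n).toMatrix 0 := by
  change opsMat [PrimOp.had (e 0)] = placeGate e hGate
  rw [opsMat_cons, opsMat_nil, Matrix.mul_one, PrimOp.mat, ← Barenco.eq_wireEmb e]

/-- The expansion is exact on `Z`. [folklore] -/
theorem opsMat_expandGate_Z (e : Fin 1 ↪ Fin n) :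
    opsMat (expandGate (QGate.gate HSignOp.Z e)) = (QGate.gate HSignOp.Z e : QGate hSign n).toMatrix 0 := by
  change opsMat [PrimOp.zed (e 0)] = placeGate e pauliZ
  rw [opsMat_cons, opsMat_nil, Matrix.mul_one, PrimOp.mat, ← Barenco.eq_wireEmb e]

/-- The expansion is exact on `CZ`. [cite: AharonovArad2011, §3.2] -/
theorem opsMat_expandGate_CZ (e : Fin 2 ↪ Fin n) :
    opsMat (expandGate (QGate.gate HSignOp.CZ e)) = (QGate.gate HSignOp.CZ e : QGate hSign n).toMatrix 0 := by
  have h01 : e 0 ≠ e 1 := fun h => by have := e.injective h; simp at this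
  change opsMat (cpOps (e 0) (e 1) h01 PhaseK.neg) = placeGate e cz
  rw [opsMat_cpOps, PhaseK.val, ← cz_eq_cphase, ← eq_pairEmb e]

/-- The expansion is exact on `CCZ`. [cite: BarencoEtAl1995, Lemma 6.1] -/
theorem opsMat_expandGate_CCZ (e : Fin 3 ↪ Fin n) :
    opsMat (expandGate (QGate.gate HSignOp.CCZ e)) = (QGate.gate HSignOp.CCZ e : QGate hSign n).toMatrix 0 := by
  have h01 : e 0 ≠ e 1 := fun h => by have := e.injective h; simp at this
  have h02 : e 0 ≠ e 2 := fun h => by have := e.injective h; simp at this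
  have h12 : e 1 ≠ e 2 := fun h => by have := e.injective h; simp at this
  change opsMat (cpOps (e 1) (e 2) h12 PhaseK.posI ++ ([PrimOp.had (e 1)] ++ cpOps (e 0) (e 1) h01 PhaseK.neg ++ [PrimOp.had (e 1)]) ++
      cpOps (e 1) (e 2) h12 PhaseK.negI ++ ([PrimOp.had (e 1)] ++ cpOps (e 0) (e 1) h01 PhaseK.neg ++ [PrimOp.had (e 1)]) ++
      cpOps (e 0) (e 2) h02 PhaseK.posI) = placeGate e ccsign
  rw [placeGate_ccsign_eq_prod e]
  simp only [opsMat_append, opsMat_cpOps, opsMat_cons, opsMat_nil, Matrix.mul_one, PrimOp.mat, PhaseK.val, ← cz_eq_cphase,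
    Matrix.mul_assoc]

/-- **The expansion is exact** on gates of the basis. [cite: AharonovArad2011, §3.2] [cite: BarencoEtAl1995, Lemma 6.1] -/
theorem opsMat_expandGate (g : HSignOp) (e : Fin (hSign.arity g) ↪ Fin n) :
    opsMat (expandGate (QGate.gate g e)) = (QGate.gate g e : QGate hSign n).toMatrix 0 := by
  cases g with
  | H => exact opsMat_expandGate_H e
  | Z => exact opsMat_expandGate_Z e
  | CZ => exact opsMat_expandGate_CZ e
  | CCZ => exact opsMat_expandGate_CCZ e

/-- **The expansion of a gate list** (operator order: the circuit's LAST gate first). [cite: AharonovArad2011, §3.2] -/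
def expandGates (gs : List (QGate hSign n)) : List (PrimOp n) := (gs.reverse.map expandGate).flatten

/-- **The expansion of an oracle-free circuit is exact**: `toMatrix gs = opsMat (expandGates gs)`.
[cite: AharonovArad2011, §3.2] -/
theorem opsMat_expandGates (gs : List (QGate hSign n)) (hgs : ∀ g ∈ gs, g.IsOracleFree) :
    opsMat (expandGates gs) = (⟨gs⟩ : QCircuit hSign n).toMatrix 0 := by
  induction gs with
  | nil => simp [expandGates, opsMat]
  | cons g gs ih =>
    rw [QCircuit.toMatrix_cons, ← ih (fun g' hg' => hgs g' (List.mem_cons_of_mem _ hg')), expandGates, List.reverse_cons,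
      List.map_append, List.flatten_append, opsMat_append, ← expandGates, List.map_singleton, List.flatten_singleton]
    congr 1
    rcases g with ⟨g, e⟩ | ⟨m, e⟩
    · exact opsMat_expandGate g e
    · exact absurd (hgs (QGate.oracle m e) (by simp)) id

end Literature.Computability.QuantumComplexity

end
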